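import Mathlib
import HarnessLib
import HarnessLib.Audit
import Summits.AtomisticToContinuum.Statement
import Literature.Geometry.DiscreteGeometry.KissingPatterns
import Summits.AtomisticToContinuum.Crystallization.Theorems.PricedLinkCensusCrysEnergyUpper

/-!
Route: ReggeStarCoercivity

DORMANT since 2026-08-26T12:41:01Z (reconciler: no traction for 7.8 d (last activity item-evidence-added at 2026-08-18T17:23:10Z); parked, not closed — `ledger route dormant route-AtomisticToContinuum-ReggeStarCoercivity --off` to react) — unstaffed, not closed; items shared with open routes are served there. `ledger route dormant <id> --off` reactivates.

# Route ReggeStarCoercivity — Regge edge-flatness + Delaunay-star LPs give a coercive Lennard-Jones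
lower bound that charges every non-close-packed shell

It suffices to show X = STAR COERCIVITY (card regge-froth-statistics-lower-bounds; conforming
re-opening of the retired
ReggeStarBounds, whose assembly stopped at the Literature decl): there are g > 0 and C such that
EVERY configuration x of N distinct
points of ℝ³ has Lennard-Jones energy E_LJ(x) ≥ N·e_per + g·#(1/20-defective sites) − C·N^(2/3),
where e_per = ⨅ over periodic
configurations Q of the energy per particle (Blanc–Lewin units V = r⁻¹²/12 − r⁻⁶/6, e_per ≈ e(hcp) ≈
−0.7175) and site i is defective
unless its recentred shell within radius 6/5, rescaled by some a ∈ [9/10, 11/10], is 1/20-matched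
after a linear isometry to the FCC
kissing pattern (cuboctahedron) or the HCP pattern (anticuboctahedron). With the trial-state upper
bound (CrysEnergyUpper, shared 0629)
and attainment of the periodic minimum (CrysPeriodicMinAttained, shared 0627) X gives the energetic
conjunct; X forces zero density of
defective shells in ground states (ZeroDefectDensity), and the positional conjunct is the bridge
crux DefectFreeCrystallizes.
Lean: `∃ g : ℝ, 0 < g ∧ ∃ C : ℝ, ∀ (N : ℕ) (x : Fin N → EuclideanSpace ℝ (Fin 3)),
Function.Injective x → (N : ℝ) * (⨅ Q :
Literature.MathematicalPhysics.StatisticalMechanics.PeriodicConfiguration 3, Q.energyPerParticle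
Literature.MathematicalPhysics.StatisticalMechanics.lennardJones) + g * (Nat.card {i : Fin N // ¬ ∃
a : ℝ, 9 / 10 ≤ a ∧ a ≤ 11 / 10 ∧ (Literature.Geometry.DiscreteGeometry.ShellCloseTo (1 / 20)
((Finset.univ.filter fun j : Fin N => j ≠ i ∧ dist (x i) (x j) ≤ 6 / 5).image fun j => a⁻¹ • (x j -
x i)) Literature.Geometry.DiscreteGeometry.fccKissingPattern ∨
Literature.Geometry.DiscreteGeometry.ShellCloseTo (1 / 20) ((Finset.univ.filter fun j : Fin N => j ≠
i ∧ dist (x i) (x j) ≤ 6 / 5).image fun j => a⁻¹ • (x j - x i))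
Literature.Geometry.DiscreteGeometry.hcpKissingPattern)} : ℝ) - C * (N : ℝ) ^ (2 / 3 : ℝ) ≤
Literature.MathematicalPhysics.StatisticalMechanics.interactionEnergy
Literature.MathematicalPhysics.StatisticalMechanics.lennardJones x`

## Assembly
Pure logic, certified sorry-free in Sketch.lean against `_root_.Crystallization` with all fourteen
items as hypotheses (the deciding
theorem `closes` of glue.lean): CoercivityForcesZeroDefects turns StarCoercivity + CrysEnergyUpper
into ZeroDefectDensity;
DefectFreeCrystallizes gives IsCrystallizing lennardJones 3; EnergyLimitGlue turns StarCoercivity +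
CrysEnergyUpper +
CrysPeriodicMinAttained into HasPeriodicGroundStateEnergy lennardJones 3; the pair is
`Crystallization` by `And.intro` (the abbrev and
the Literature def unfold). StabilityConstantTwelve, PeriodicStarCoercivity and the four
provable-now supports are rungs and records of
the same engine, not load-bearing in `closes`.

Rationale: WHY THIS LINE. Every two-dimensional crystallization proof is combinatorial at heart
(HeitmannRadin1980; LucaFriesecke2016, arXiv:1605.00034: Euler's
formula shares each bond among faces and bounds the bond count); in ℝ³ Euler on the bond graph is
useless, but Regge calculus names the
replacement — flat space ⟺ zero deficit angle at every EDGE — which, written as unit-ball volume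
fractions, gives two exact,
potential-independent partition-of-unity identities on any Delaunay triangulation (solid-angle
fractions at an interior vertex sum to 1,
dihedral fractions around an interior edge sum to 1; items SolidAngleFlatness, DihedralFlatness), so
that N and the bond energy become
sums of ANGLE-WEIGHTED simplex functionals (Coxeter1958's froth statistics, which predicted
coordination 13.56 for ideal tetrahedral
packing; Rogers1958 is the density case at level 1). Tetrahedral frustration then enters as a LINEAR
constraint in angle-statistics space
(5θ_tet = 352.6° < 360° < 6θ_tet; tree `five_mul_lt_two_pi`, `two_tet_add_two_oct`) instead of as an
enemy, and lower bounds on e*_LJ(3D)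
become finite LPs over edge-stars and vertex-stars coupled by flatness and marginal consistency,
certifiable by rational LP duals +
interval arithmetic (kit) — the energy twin of the Delaunay-star programme Hales1992/Hales1997 ran
for DENSITY (HalesDSP2012 Ch. 6).
Imported areas: discrete differential geometry (Regge/Gauss–Bonnet), computational geometry
(Delaunay, slivers), LP duality and
certified computation; the unconditional rung StabilityConstantTwelve competes with Yuhjtman2015
(arXiv:1501.05248, B ≤ 14.316ε by
one-centre subharmonic averaging). Versus the predecessor and the negatives index: the deciding
theorem now reaches `_root_.Crystallization`
(certified sorry-free), attainment is imported as the shared item 0627 instead of being bundled into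
the bridge, every configuration in X
is injective (the pile-up witness of OneGrainGluing_refuted is excluded) and no shell is inferred
from soft kissing (DecahedralSoftShell /
EffectiveLocalHales_refuted are priced, not assumed away).

RANKED CRUXES. #2 StarCoercivity (crux) — STAR COERCIVITY (thesis X, card items G1–G4): E_LJ(x) ≥
N·e_per + g·#(1/20-defective first shells) − C·N^(2/3) for every injective configuration of N points
in ℝ³; e_per = ⨅ periodic energy per particle; defect = recentred shell within 6/5, rescaled by a ∈
[0.9, 1.1], not 1/20-matched after a linear isometry to fccKissingPattern / hcpKissingPattern
(Barlow sites at any admissible dilation are free; surface, over/under-coordinated, icosahedral,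
decahedral-axis and ≥ 5 %-strained sites are charged). Intended proof: Delaunay triangulation + far
ghost vertices; flatness identities N = Σ_t ω(t), E_bonds = Σ_t ε(t); non-Delaunay pairs charged to
the cells their segment crosses; slivers merged into ε-cospherical Delaunay polytopes; one
inequality 'score ≥ g·[defect share]' per edge-star / vertex-star proved as a certified LP dual;
vacuum cells have positive score −e_per·ω, so no separate boundary term is expected. [difficulty:
XL] (why it might fail: g is pinned ≤ ~1e-3/site by strained decahedral axes (DecahedralSoftShell:
five tetrahedra close at 0.67 % strain) and icosahedral Z12 stars beat cuboctahedral ones locally,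
so coupled star LPs must resolve 1e-3 — the scale at which Hales's Delaunay-star density programme
leaked (0.740873).) [LucaFriesecke2016, Regge1961, Coxeter1958, Rogers1958, Hales1992, Hales1997,
HalesDSP2012, Lagarias2002LocalDensity]
#3 StabilityConstantTwelve (crux) — STABILITY CONSTANT TWELVE — the unconditional rung of the same
engine (card deliverable (a)): E(N) ≥ −N for every N (Blanc–Lewin units), i.e. Yuhjtman's certified
stability constant B_LJ ≤ 14.316ε (E/N ≥ −1.193; arXiv:1501.05248 Thm 9) improved to B_LJ ≤ 12ε;
truth ≈ 8.61ε (e_per ≈ −0.7175). Intended proof: level 1–2 angle-weighted cells on a Delaunay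
triangulation of an arbitrary injective configuration, sliver merging, crude certified charge of the
non-Delaunay r⁻⁶ tail; no sharpness, no coercivity. By BlancLewin2015_8_holds it is equivalent to
e_∞ ≥ −1. [difficulty: L] (why it might fail: False only if e_∞ < −1 (numerics ≥ −0.72). Risk =
certifiability: after sliver merging, the level-1/2 cell constant (bond part −0.558/unit weight)
plus a rigorous non-Delaunay r⁻⁶ tail charge for arbitrary unseparated configurations must stay
above −1; a poor tail constant eats the 0.25 margin.) [Yuhjtman2015, arXiv:1501.05248,
DelimaProcacciYuhjtman2015, BlancLewin2015, Rogers1958, HalesDSP2012]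
#4 PeriodicStarCoercivity (crux) — PERIODIC STAR COERCIVITY — the torus twin of X: there is g > 0
with e(P) ≥ e_per + g·(fraction of 1/20-defective motif points) for EVERY periodic configuration P
of ℝ³ (defect as in X, shells read in P.points). On ℝ³/G the Delaunay triangulation is finite and
flatness holds at every vertex and edge, so #F = Σ_t ω(t), E_bonds = Σ_t ε(t) are exact with no
boundary — the cleanest home of the mechanism and a consequence of X by trial blocks; it feeds
CrysPeriodicMinAttained (0627) in other routes and is the statement refuters can test on explicit
periodic competitors (bcc: defective everywhere, excess ≈ 0.03; A15/σ Frank–Kasper: excess ~1e-2;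
vacancy superlattices: excess ≈ 0.7/M against ≤ 13/M defective). [deps: StarCoercivity] [difficulty:
XL] (why it might fail: Must hold for ALL periodic P (porous, huge-motif, strained); false if some
non-Barlow periodic structure comes within o(defect fraction) of e_per — Frank–Kasper phases sit
only ~1e-2 above and decahedral/vacancy superlattices pin g ≤ 1e-3; provability needs a periodic
Delaunay API (none in Mathlib).) [Coxeter1958, FrankKasper1958, Hales1997, HalesDSP2012,
BlancLewin2015, Stillinger2001, PartayOrtnerCsanyi2017]
#5 DefectFreeCrystallizes (crux) — THE POSITIONAL BRIDGE: if along every sequence of Lennard-Jones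
ground states the fraction of 1/20-defective first shells tends to 0 (ZeroDefectDensity), then
IsCrystallizing lennardJones 3. Intended proof: uniform separation
(LennardJonesMinimalDistance_holds) + counting give defect-free windows of radius R_j → ∞ around
most particles; a tolerance-robust layer lemma (every shell 1/20-close to FCC/HCP ⇒ the window is a
relaxed Barlow stacking with locally constant scale; exact case = tree
HalesDSP_stackingShells_holds) makes windows layered; exact minimality bounds the stacking-fault
budget by the N^(2/3) boundary energy over the ~1e-4 Hägg energy differences, so periodic (hcp-type)
blocks of growing height exist; surface-stress strain ~N^(−1/3) → 0; vague compactness of translated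
windows then gives a non-zero periodic limit with multiplicity 1. [deps: StarCoercivity]
[difficulty: XL] (why it might fail: Zero defect DENSITY leaves stacking and long-wave strain free:
FCC/HCP-type shells mix in aperiodic Barlow stackings, so a PERIODIC local limit needs energetic
stacking selection (Hägg domination 0737, open; PartayOrtnerCsanyi2017 polytypes) and a 1/20-robust
layer lemma (tree: exact case only).) [Hales2012, HalesDSP2012, BlancLewin2015,
PartayOrtnerCsanyi2017, FlatleyTheil2015, Radin1991]
#9 CrysEnergyUpper (support) — shared item 0629, the easy half of energetic crystallization: limsup
E(N)/N ≤ ⨅ over periodic configurations of the LJ energy per particle (finite blocks of a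
near-optimal periodic configuration as trial states; boundary O(N^(2/3)); r⁻⁶ tail summable in d =
3). [difficulty: M] [BlancLewin2015]
#9 CrysPeriodicMinAttained (support) — shared item 0627: the infimum over periodic configurations of
ℝ³ of the LJ energy per particle is attained. Imported here (owned by the stacking-selection
routes); needed because HasPeriodicGroundStateEnergy asks for an attained minimum. Foreseen
alternative child: IsCrystallizing + cut-and-paste minimality ⇒ the local limit attains e_per.
[difficulty: L] [BlancLewin2015, BeterminSamajTravenec2022]
#9 ZeroDefectDensity (support) — derived statement (H3 of the retired hull-exactification cascade,
metric form): along every sequence of LJ ground states the fraction of particles whose first shell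
(radius 6/5, rescaled by a ∈ [0.9, 1.1]) is not 1/20-close after a linear isometry to the FCC or HCP
kissing pattern tends to 0. Follows from StarCoercivity + CrysEnergyUpper
(CoercivityForcesZeroDefects); consumed by DefectFreeCrystallizes; filed as its own decl so other
routes can want it by signature. [difficulty: XL] [BlancLewin2015, Hales2012]
#9 CoercivityForcesZeroDefects (support) — elementary real-analysis glue: StarCoercivity →
CrysEnergyUpper → ZeroDefectDensity. Proof: a ground state x^N is injective with E_LJ(x^N) = E(N);
StarCoercivity gives g·#def ≤ E(N) − N·e_per + C·N^(2/3); BlancLewin2015_8_holds (proved) gives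
E(N)/N → e_∞ and CrysEnergyUpper gives e_∞ ≤ e_per, hence #def/N ≤ (E(N)/N − e_∞)/g + C·N^(−1/3)/g →
0. [difficulty: provable-now] [BlancLewin2015]
#9 EnergyLimitGlue (support) — elementary glue for the energetic conjunct: StarCoercivity →
CrysEnergyUpper → CrysPeriodicMinAttained → HasPeriodicGroundStateEnergy lennardJones 3. Proof:
IsLeast P gives ⨅_Q e(Q) = e(P) (IsLeast.csInf_eq) and BddBelow; StarCoercivity with the g-term
dropped and le_ciInf over injective configurations gives E(N)/N ≥ e(P) − C·N^(−1/3); with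
BlancLewin2015_8_holds (E(N)/N → e_∞, proved) this yields e_∞ ≥ e(P), CrysEnergyUpper yields e_∞ ≤
e(P), so E(N)/N → e(P) and ⟨P, IsLeast, Tendsto⟩. [difficulty: provable-now] [BlancLewin2015]
#9 SolidAngleFlatness (support) — 3-D Gauss–Bonnet is flatness, vertex form, as pure measure theory:
for finitely many non-degenerate tetrahedra conv(v, p_k0, p_k1, p_k2) sharing the apex v with
pairwise disjoint interiors, the unit-ball volume fractions at v of their apex cones (= solid
angles/4π) sum to ≤ 1, with equality when the tetrahedra cover a neighbourhood of v (cones are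
dilation invariant; a.e.-disjointness + additivity of volume). This is N = Σ_t ω(t) at interior
vertices, with the inequality direction lower bounds need. [difficulty: provable-now] [Rogers1958,
Coxeter1958]
#9 DihedralFlatness (support) — edge form (Regge: zero deficit angle at every interior edge of a
flat triangulation): for non-degenerate tetrahedra conv(v, w, p_k0, p_k1) sharing the edge vw with
pairwise disjoint interiors, the unit-ball volume fractions at v of their dihedral wedges ℝ(w−v) +
cone(p_k0−v, p_k1−v) (= dihedral angle/2π) sum to ≤ 1, with equality when the tetrahedra cover a
neighbourhood of the midpoint of vw. Gives E_bonds = Σ_t ε(t) with ε(t) = Σ_edges (θ_e,t/2π)·V(|e|)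
— Coxeter's froth sharing of each bond among the simplices around it. [difficulty: provable-now]
[Regge1961, Coxeter1958, Rogers1958]
#9 LevelOneFrustrationGap (support) — certified number (card deliverable (b) at level 1; energy twin
of fccDensity_lt_rogersBound): the regular unit tetrahedron's angle-weighted energy per unit
particle-weight, ε/ω = −θ/(4(3θ−π)) ∈ (−0.55824, −0.55816) with θ = arccos(1/3), lies strictly below
6·V(1) + V(√2) = −0.51953…, the Delaunay-edge energy per particle of the unit fcc lattice; so a RAW
per-simplex bound leaks by ≥ 7 % for the bond energy (Rogers: 5 % for density) —
TetrahedralFrustration made quantitative for energy; interval arithmetic from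
tetDihedralAngle_bounds. [difficulty: provable-now] [Rogers1958, HalesDSP2012]
#9 SliverCellsUnbounded (support) — negative knowledge (the card's fastest refutation of RAW level
1, recorded as a lemma): for every ℓ there is a non-degenerate tetrahedron with all six edge lengths
in [1, 2] whose dihedral-weighted LJ edge energy is < ℓ × its total solid-angle weight. Witness:
slivers — four points of a unit square lifted by h → 0 (the two diagonals get dihedral fraction →
1/2 each, ε → V(√2) < 0, all four solid angles → 0). Hence cells must be merged or scores
apportioned to stars before any LP. [difficulty: provable-now] [HalesDSP2012]

TWO-LAYER PLAN. Foreseen glued splits (none filed now): StarCoercivity ⇐ StarIdentities (Delaunay +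
ghost vertices + the two flatness identities + face
charge of non-Delaunay pairs, for δ-separated finite sets) → StarInequality (the certified level-k
LP dual: score ≥ g·defect share per
vertex-star) → StarCoercivity; StabilityConstantTwelve ⇐ PeriodicStabilityTwelve (e(P) ≥ −1 on the
torus, the machine's cheapest full
run) → TailChargeTwelve (non-Delaunay r⁻⁶ tail for arbitrary configurations) →
StabilityConstantTwelve; DefectFreeCrystallizes ⇐
RobustLayerLemma (1/20-close shells on a window ⇒ relaxed Barlow stacking) → FaultBudget (o(N)
non-hcp-type layers in ground states, via
Hägg domination 0737) → DefectFreeCrystallizes. CrysPeriodicMinAttained has the alternative child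
IsCrystallizing + cut-and-paste ⇒ attained.

KILL CRITERIA. (a) A primal witness for the LP: a translation-invariant star statistics (icosahedral
5-rings mixed with 6-rings at Coxeter's ratio, or a
Frank–Kasper phase with relaxed edge lengths) satisfying every level-3 flatness/consistency
constraint with energy + tail charge <
e(hcp) − 3 % ⇒ stars are provably too local ⇒ StarCoercivity unprovable by this mechanism ⇒ close
`exhausted` after recording the certified
ℓ_k (StabilityConstantTwelve may still close as a Literature-grade bound). (b) A theorem or
certified numerics exhibiting a non-Barlow
periodic structure within g → 0 of e(hcp) per defective site refutes PeriodicStarCoercivity and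
StarCoercivity outright — close
`refuted:StarCoercivity`. (c) StabilityConstantTwelve is refuted only by e_∞ < −1 (excluded by all
cluster numerics). (d) Aperiodic or
degenerate optimal LJ stackings (¬CrysPeriodicMinAttained, the RefuteCrystalPeriodicMin line) kill
DefectFreeCrystallizes and the
conjunct itself. Proved elsewhere: BulkDefectVanish (0751) + DefectVanishCrystallizes (0752) moot
DefectFreeCrystallizes; CrysEnergyLimit
(0626) with 0627 moots the energetic half.

NOT DECOMPOSED YET. By design (D-0019): existence/API of Delaunay triangulations of δ-separated
finite and periodic point sets (definition request), the
cell-merging rule for slivers (ε-cospherical clusters → Delaunay polytopes incl. fcc octahedra;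
SliverCellsUnbounded shows why), the
apportioning of simplex scores to edge- and vertex-stars, the tail charge beyond the second shell,
the LP discretisation with Lipschitz
slack and its kit certification, boundary bookkeeping (expected unnecessary: vacuum cells score
−e_per·ω > 0), the robust layer lemma and
the fault budget inside DefectFreeCrystallizes. All become layer-2 children once a crux moves.

CHEAPEST FALSIFIER. Run the level-2 EDGE-STAR LP numerically before certifying anything (kit,
floating point, a few hundred variables): variables =
distributions over (valence n_e ∈ {3,…,7}, edge-length/dihedral tuples on a 0.02 grid), constraints
= flatness Σθ = 2π per edge +
marginal consistency of shared tetrahedra + Euler/Dehn–Sommerville counts, objective = Σε +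
face-charged √2-shell. If its optimum sits
> 3 % below e(hcp) = −0.7175 while Coxeter's 5.1-ring statistics is primal-feasible there, levels ≤
2 are dead and only vertex-stars
remain; if even the raw level-1 constant with slivers merged cannot be pushed above −1 − (tail),
StabilityConstantTwelve is out of reach
too. Not run this session (compute-free hub; kit job to be filed by the first prover). Lookup
already done: Yuhjtman2015 B ≤ 14.316ε is
the record to beat (DelimaProcacciYuhjtman2015 §5.2).

NUMBERS. Blanc–Lewin units (V = r⁻¹²/12 − r⁻⁶/6, min −1/12 at r = 1): e(fcc) ≈ e(hcp) ≈ −0.7175 (=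
−8.61ε/12; hcp below fcc by ~1e-4 relative),
nearest-neighbour distance a* ≈ 0.9712; Yuhjtman2015: E(N) ≥ −1.193N (B ≤ 14.316ε), minimal distance
0.684 in his normalisation;
tree: LennardJonesMinimalDistance_holds (δ = 1/3), θ_tet = arccos(1/3) ∈ (1.230956, 1.23098), 2π −
5θ ≈ 0.1283 (7.36°), σ₃ ∈ (0.7796,
0.7798) vs π/√18 = 0.74048, Delaunay-star leak 0.740873 (delaunayStarBound_pentahedralPrism_bounds);
level 1 energy: −0.5582 (regular
unit simplex ε/ω) vs −0.5195 (fcc Delaunay edges); decahedral closure strain η⋆ ≈ 0.0067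
(DecahedralSoftShell); items at open: 14.

DEFINITION REQUESTS. DelaunayTriangulation of a locally finite (δ-separated) point set of ℝ³ and of
a periodic configuration on ℝ³/G (topic
Literature/Geometry/DiscreteGeometry): simplices, empty-sphere property, genericity/tie-breaking,
interior edge and vertex stars — to be
filed with `ledger workitem add --kind definition --notion DelaunayTriangulation` for StarCoercivity
once the route id exists. Bib:
Regge 1961 (General relativity without coordinates, Nuovo Cimento 19) to be added as a key when lit
is reachable.

Novelty: Searches (2026-08-15): `lit frontier AtomisticToContinuum --since 2020` (30 rows;
crystallization-relevant: arXiv:2407.20762 planar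
arbitrary-norm crystallization; arXiv:2604.19239 Kreutz–Ziereis, rigid polycrystals by Γ-convergence
for DESIGNED frame-invariant
energies that charge every atom not locally isometric to a reference lattice (read pp. 1–3) —
exactly the shape N·e + g·#defects that X
asserts Lennard-Jones DOMINATES; neither gives a 3-D lower bound for a physical pair potential);
`lit bridges AtomisticToContinuum --cross any` (30 rows, none on local energy inequalities); `lit
galaxy search "statistical honeycomb" --star all` (10 rows: Coxeter, Introduction to Geometry;
Sadoc–Mosseri, Geometrical Frustration;
Nelson, Defects and Geometry in Condensed Matter Physics; Nelson–Widom 1984 polytope models of glass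
— the physics of Coxeter's froth
{3,3,5.1}, no rigorous energy bounds); `lit galaxy search "stability constant of the Lennard-Jones"
--star all` (0);
`lit search --source crossref "minimal energy Lennard-Jones configurations lower bound Delaunay
tetrahedra dihedral"` (8, none on
angle-weighted cell bounds; Blanc 2004 doi:10.1023/b:coap.0000039486.97389.87 minimal distance);
`lit search --source zbmath
"Lennard-Jones ground state energy lower bound"` (2: Blanc 2004; Schachinger–Addis–Bomze 2007
doi:10.1007/s10589-007-9051-y,
distance/energy bounds for LJ clusters by one-centre counting); `lit search --source arxiv "lower
bound Lennard-Jones ground state energy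
thr  [refs: 10.1023/b:coap.0000039486.97389.87, 10.1007/s10589-007-9051-y, 10.1007/s00332-017-9401-6, 10.1215/ijm/1255448337, 2407.20762, 2604.19239, 2005.10362, 1501.05248, doi:10.1023/b, doi:10.1007/s10589-007-9051-y, doi:10.1007/s00332-017-9401-6, doi:10.1215/ijm/1255448337, HalesDSP2012, Yuhjtman2015, DelimaProcacciYuhjtman2015, LucaFriesecke2016, Coxeter1958, Rogers1958, Hales1992, Hales1993, Hales1997]

Barriers (technique_class: regge-angle-weights delaunay-star-lp rogers-simplex-bound): - technique_class: regge-angle-weights delaunay-star-lp rogers-simplex-bound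
- Literature.Barriers.AtomisticToContinuum.TetrahedralFrustration: APPLIES HEAD-ON to raw level 1 —
a per-simplex energy bound is a pure Delaunay-simplex bound and is not sharp, recorded
quantitatively as LevelOneFrustrationGap (−0.5582 < −0.5195) and SliverCellsUnbounded (raw level 1 =
−∞). Evasion = the barrier's own scope caveat (TetrahedralFrustrationNarrow;
Lagarias2002LocalDensity Remark (2): only volume-independent single-cell functionals with no
reapportioning are obstructed): levels 2–3 reapportion simplex scores across edge- and vertex-stars
where flatness COUPLES simplices (2θ_tet + 2θ_oct = 2π, tree two_tet_add_two_oct), a hybrid in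
Hales's sense. Residual risk declared: the Delaunay-star density programme leaked at 5e-4
(delaunayStarBound_pentahedralPrism_bounds) and g here lives at 1e-3.
- Literature.Barriers.AtomisticToContinuum.TetrahedralFrustrationNarrow: APPLIES exactly to RAW
level 1 (a volume-independent single-cell bound: one simplex, no reapportioning) — and the route
records that level 1 fails quantitatively (LevelOneFrustrationGap, SliverCellsUnbounded); every
bound actually claimed (StabilityConstantTwelve, PeriodicStarCoercivity, StarCoercivity) is a
multi-cell inequality with reapportioning across edge- /vertex-stars and zero-sum flatness
corrections, i.e. inside Lagarias's admissible class (Lagarias2002LocalDensity Definitions 2.3–2.5),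
which the narrowed barrier explicitl

History (route lifecycle, newest last):
- 2026-08-26T12:41:01Z · DORMANT — reconciler: no traction for 7.8 d (last activity item-evidence-added at 2026-08-18T17:23:10Z); parked, not closed — `ledger route dormant route-AtomisticToConti (operator:999:2590407)

sub-problem: Crystallization · status: dormant · opened planner-plancard-AtomisticToContinuum-Crystal-8fa53ff6-g2-0 2026-08-15T19:02:27Z · rev 1 · ledger route-AtomisticToContinuum-ReggeStarCoercivity
GENERATED by the gate from the ledger (D-0016/17). Provers cite these decls: `theorem foo : Summit.AtomisticToContinuum.Crystallization.Theses.ReggeStarCoercivity.<Decl> := …` in Summits/AtomisticToContinuum/Crystallization/Theorems/<Name>.lean.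
-/

namespace Summit.AtomisticToContinuum.Crystallization.Theses.ReggeStarCoercivity

open scoped BigOperators Topology Manifold Classical MeasureTheory ProbabilityTheory Matrix InnerProductSpace ComplexConjugate ContinuousMap
open Filter Set Function TopologicalSpace MeasureTheory

attribute [summit_statement] _root_.Crystallization

/-- item stmt-AtomisticToContinuum-13600 · crux · rank 2 · open · by planner
why it might fail: g is pinned ≤ ~1e-3/site by strained decahedral axes (DecahedralSoftShell: five tetrahedra close at 0.67 % strain) and icosahedral Z12 stars beat cuboctahedral ones locally, so coupled star LPs must resolve 1e-3 — the scale at which Hales's Delaunay-star density programme leaked (0.740873).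
sources: LucaFriesecke2016, Regge1961, Coxeter1958, Rogers1958, Hales1992, Hales1997
[crux] STAR COERCIVITY (thesis X, card items G1–G4): E_LJ(x) ≥ N·e_per + g·#(1/20-defective first
shells) − C·N^(2/3) for every injective configuration of N points in ℝ³; e_per = ⨅ periodic energy
per particle; defect = recentred shell within 6/5, rescaled by a ∈ [0.9, 1.1], not 1/20-matched
after a linear isometry to fccKissingPattern / hcpKissingPattern (Barlow sites at any admissible
dilation are free; surface, over/under-coordinated, icosahedral, decahedral-axis and ≥ 5 %-strained
sites are charged). Intended proof: Delaunay triangulation + far ghost vertices; flatness identities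
N = Σ_t ω(t), E_bonds = Σ_t ε(t); non-Delaunay pairs charged to the cells their segment crosses;
slivers merged into ε-cospherical Delaunay polytopes; one inequality 'score ≥ g·[defect share]' per
edge-star / vertex-star proved as a certified LP dual; vacuum cells have positive score −e_per·ω, so
no separate boundary term is expected. [difficulty: XL] -/
@[route_item "route-AtomisticToContinuum-ReggeStarCoercivity"]
def StarCoercivity : Prop :=
  ∃ g : ℝ, 0 < g ∧ ∃ C : ℝ, ∀ (N : ℕ) (x : Fin N → EuclideanSpace ℝ (Fin 3)), Function.Injective x → (N : ℝ) * (⨅ Q : Literature.MathematicalPhysics.StatisticalMechanics.PeriodicConfiguration 3, Q.energyPerParticle Literature.MathematicalPhysics.StatisticalMechanics.lennardJones) + g * (Nat.card {i : Fin N // ¬ ∃ a : ℝ, 9 / 10 ≤ a ∧ a ≤ 11 / 10 ∧ (Literature.Geometry.DiscreteGeometry.ShellCloseTo (1 / 20) ((Finset.univ.filter fun j : Fin N => j ≠ i ∧ dist (x i) (x j) ≤ 6 / 5).image fun j => a⁻¹ • (x j - x i)) Literature.Geometry.DiscreteGeometry.fccKissingPattern ∨ Literature.Geometry.DiscreteGeometry.ShellCloseTo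 (1 / 20) ((Finset.univ.filter fun j : Fin N => j ≠ i ∧ dist (x i) (x j) ≤ 6 / 5).image fun j => a⁻¹ • (x j - x i)) Literature.Geometry.DiscreteGeometry.hcpKissingPattern)} : ℝ) - C * (N : ℝ) ^ (2 / 3 : ℝ) ≤ Literature.MathematicalPhysics.StatisticalMechanics.interactionEnergy Literature.MathematicalPhysics.StatisticalMechanics.lennardJones x

/-- item stmt-AtomisticToContinuum-13601 · crux · rank 3 · closed · proved by Summit.AtomisticToContinuum.Crystallization.Theorems.stabilityConstantTwelve_proof @ d51405d93a2f (prover) · by planner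
why it might fail: False only if e_∞ < −1 (numerics ≥ −0.72). Risk = certifiability: after sliver merging, the level-1/2 cell constant (bond part −0.558/unit weight) plus a rigorous non-Delaunay r⁻⁶ tail charge for arbitrary unseparated configurations must stay above −1; a poor tail constant eats the 0.25 margin.
sources: Yuhjtman2015, arXiv:1501.05248, DelimaProcacciYuhjtman2015, BlancLewin2015, Rogers1958, HalesDSP2012
[crux] STABILITY CONSTANT TWELVE — the unconditional rung of the same engine (card deliverable (a)):
E(N) ≥ −N for every N (Blanc–Lewin units), i.e. Yuhjtman's certified stability constant B_LJ ≤
14.316ε (E/N ≥ −1.193; arXiv:1501.05248 Thm 9) improved to B_LJ ≤ 12ε; truth ≈ 8.61ε (e_per ≈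
−0.7175). Intended proof: level 1–2 angle-weighted cells on a Delaunay triangulation of an arbitrary
injective configuration, sliver merging, crude certified charge of the non-Delaunay r⁻⁶ tail; no
sharpness, no coercivity. By BlancLewin2015_8_holds it is equivalent to e_∞ ≥ −1. [difficulty: L] -/
@[route_item "route-AtomisticToContinuum-ReggeStarCoercivity"]
def StabilityConstantTwelve : Prop :=
  ∀ N : ℕ, -(N : ℝ) ≤ Literature.MathematicalPhysics.StatisticalMechanics.groundStateEnergy Literature.MathematicalPhysics.StatisticalMechanics.lennardJones 3 N

-- `StabilityConstantTwelve` holds: proved by `Summit.AtomisticToContinuum.Crystallization.Theorems.stabilityConstantTwelve_proof` @ d51405d93a2f (its module imports this route file, so no `_holds` link can be stated here).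

/-- item stmt-AtomisticToContinuum-13602 · crux · rank 4 · open · by planner
why it might fail: Must hold for ALL periodic P (porous, huge-motif, strained); false if some non-Barlow periodic structure comes within o(defect fraction) of e_per — Frank–Kasper phases sit only ~1e-2 above and decahedral/vacancy superlattices pin g ≤ 1e-3; provability needs a periodic Delaunay API (none in Mathlib).
sources: Coxeter1958, FrankKasper1958, Hales1997, HalesDSP2012, BlancLewin2015, Stillinger2001
[crux] PERIODIC STAR COERCIVITY — the torus twin of X: there is g > 0 with e(P) ≥ e_per +
g·(fraction of 1/20-defective motif points) for EVERY periodic configuration P of ℝ³ (defect as in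
X, shells read in P.points). On ℝ³/G the Delaunay triangulation is finite and flatness holds at
every vertex and edge, so #F = Σ_t ω(t), E_bonds = Σ_t ε(t) are exact with no boundary — the
cleanest home of the mechanism and a consequence of X by trial blocks; it feeds
CrysPeriodicMinAttained (0627) in other routes and is the statement refuters can test on explicit
periodic competitors (bcc: defective everywhere, excess ≈ 0.03; A15/σ Frank–Kasper: excess ~1e-2;
vacancy superlattices: excess ≈ 0.7/M against ≤ 13/M defective). [deps: StarCoercivity] [difficulty:
XL] -/
@[route_item "route-AtomisticToContinuum-ReggeStarCoercivity"]
def PeriodicStarCoercivity : Prop :=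
  ∃ g : ℝ, 0 < g ∧ ∀ P : Literature.MathematicalPhysics.StatisticalMechanics.PeriodicConfiguration 3, (⨅ Q : Literature.MathematicalPhysics.StatisticalMechanics.PeriodicConfiguration 3, Q.energyPerParticle Literature.MathematicalPhysics.StatisticalMechanics.lennardJones) + g * ((P.motif.filter fun s => ¬ ∃ a : ℝ, 9 / 10 ≤ a ∧ a ≤ 11 / 10 ∧ (Literature.Geometry.DiscreteGeometry.ShellCloseTo (1 / 20) ((P.finite_inter_points (K := Metric.closedBall s (6 / 5) \ {s}) (Metric.isBounded_closedBall.subset Set.sdiff_subset)).toFinset.image fun y => a⁻¹ • (y - s)) Literature.Geometry.DiscreteGeometry.fccKissingPattern ∨ Literature.Geometry.DiscreteGeometry.ShellCloseTo (1 / 20) ((P.finite_inter_points (K := Metric.closedBall s (6 / 5) \ {s}) (Metric.isBounded_closedBall.subset Set.sdiff_subset)).toFinset.image fun y => a⁻¹ • (y - s)) Literature.Geometry.DiscreteGeometry.hcpKissingPattern)).card : ℝ) / (P.motif.card : ℝ) ≤ P.energyPerParticle Literature.MathematicalPhysics.StatisticalMechanics.lennardJones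

/-- item stmt-AtomisticToContinuum-13603 · crux · rank 5 · open · by planner
why it might fail: Zero defect DENSITY leaves stacking and long-wave strain free: FCC/HCP-type shells mix in aperiodic Barlow stackings, so a PERIODIC local limit needs energetic stacking selection (Hägg domination 0737, open; PartayOrtnerCsanyi2017 polytypes) and a 1/20-robust layer lemma (tree: exact case only).
sources: Hales2012, HalesDSP2012, BlancLewin2015, PartayOrtnerCsanyi2017, FlatleyTheil2015, Radin1991
[crux] THE POSITIONAL BRIDGE: if along every sequence of Lennard-Jones ground states the fraction of
1/20-defective first shells tends to 0 (ZeroDefectDensity), then IsCrystallizing lennardJones 3.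
Intended proof: uniform separation (LennardJonesMinimalDistance_holds) + counting give defect-free
windows of radius R_j → ∞ around most particles; a tolerance-robust layer lemma (every shell
1/20-close to FCC/HCP ⇒ the window is a relaxed Barlow stacking with locally constant scale; exact
case = tree HalesDSP_stackingShells_holds) makes windows layered; exact minimality bounds the
stacking-fault budget by the N^(2/3) boundary energy over the ~1e-4 Hägg energy differences, so
periodic (hcp-type) blocks of growing height exist; surface-stress strain ~N^(−1/3) → 0; vague
compactness of translated windows then gives a non-zero periodic limit with multiplicity 1. [deps:
StarCoercivity] [difficulty: XL] -/
@[route_item "route-AtomisticToContinuum-ReggeStarCoercivity"]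
def DefectFreeCrystallizes : Prop :=
  (∀ x : (N : ℕ) → (Fin N → EuclideanSpace ℝ (Fin 3)), (∀ N, Literature.MathematicalPhysics.StatisticalMechanics.IsGroundState Literature.MathematicalPhysics.StatisticalMechanics.lennardJones (x N)) → Filter.Tendsto (fun N : ℕ => (Nat.card {i : Fin N // ¬ ∃ a : ℝ, 9 / 10 ≤ a ∧ a ≤ 11 / 10 ∧ (Literature.Geometry.DiscreteGeometry.ShellCloseTo (1 / 20) ((Finset.univ.filter fun j : Fin N => j ≠ i ∧ dist (x N i) (x N j) ≤ 6 / 5).image fun j => a⁻¹ • (x N j - x N i)) Literature.Geometry.DiscreteGeometry.fccKissingPattern ∨ Literature.Geometry.DiscreteGeometry.ShellCloseTo (1 / 20) ((Finset.univ.filter fun j : Fin N => j ≠ i ∧ dist (x N i) (x N j) ≤ 6 / 5).image fun j => a⁻¹ • (x N j - x N i)) Literature.Geometry.DiscreteGeometry.hcpKissingPattern)} : ℝ) / N) Filter.atTop (nhds 0)) → Literature.MathematicalPhysics.StatisticalMechanics.IsCrystallizing Literature.MathematicalPhysics.StatisticalMechanics.lennardJones 3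

/-- item stmt-AtomisticToContinuum-0627 · support · rank 9 · open · by planner
sources: BlancLewin2015, BeterminSamajTravenec2022
The infimum over periodic configurations of ℝ³ of the Lennard-Jones energy per particle is attained
(by some lattice G and finite motif F). Needs stacking selection (c) + compactness of near-optimal
periodic configurations at bounded density / bounded-below distances; refuted if optimal LJ
stackings are aperiodic with unattained infimum (route RefuteCrystalPeriodicMin). -/
@[route_item "route-AtomisticToContinuum-ReggeStarCoercivity"]
def CrysPeriodicMinAttained : Prop :=
  ∃ P : Literature.MathematicalPhysics.StatisticalMechanics.PeriodicConfiguration 3, IsLeast (Set.range fun Q : Literature.MathematicalPhysics.StatisticalMechanics.PeriodicConfiguration 3 => Q.energyPerParticle Literature.MathematicalPhysics.StatisticalMechanics.lennardJones) (P.energyPerParticle Literature.MathematicalPhysics.StatisticalMechanics.lennardJones)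

/-- item stmt-AtomisticToContinuum-11865 · support · rank 9 · closed · proved by Summit.AtomisticToContinuum.Crystallization.Theorems.crysEnergyUpper_proof @ b1410290bb74 (prover) · by planner
sources: BlancLewin2015
[support] trial-state upper bound limsup E(N)/N ≤ ⨅ over periodic Q of e_LJ(Q) (shared item 0629,
same signature: finite blocks of Q plus far-away extras, boundary O(N^{2/3}), r⁻⁶ tail summable in d
= 3; le_ciInf needs only Nonempty; coboundedness of the limsup from BlancLewin2015_8_holds /
lennardJones_stable_holds, both proved in tree). [difficulty: provable-now] -/
@[route_item "route-AtomisticToContinuum-ReggeStarCoercivity"]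
def CrysEnergyUpper : Prop :=
  Filter.limsup (fun N : ℕ => Literature.MathematicalPhysics.StatisticalMechanics.groundStateEnergy Literature.MathematicalPhysics.StatisticalMechanics.lennardJones 3 N / N) Filter.atTop ≤ ⨅ Q : Literature.MathematicalPhysics.StatisticalMechanics.PeriodicConfiguration 3, Q.energyPerParticle Literature.MathematicalPhysics.StatisticalMechanics.lennardJones

/-- `CrysEnergyUpper` holds: proved by `Summit.AtomisticToContinuum.Crystallization.Theorems.crysEnergyUpper_proof` @ b1410290bb74. -/
theorem CrysEnergyUpper_holds : CrysEnergyUpper := _root_.Summit.AtomisticToContinuum.Crystallization.Theorems.crysEnergyUpper_proof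

/-- item stmt-AtomisticToContinuum-13604 · support · rank 9 · open · by planner
sources: BlancLewin2015, Hales2012
[support] derived statement (H3 of the retired hull-exactification cascade, metric form): along
every sequence of LJ ground states the fraction of particles whose first shell (radius 6/5, rescaled
by a ∈ [0.9, 1.1]) is not 1/20-close after a linear isometry to the FCC or HCP kissing pattern tends
to 0. Follows from StarCoercivity + CrysEnergyUpper (CoercivityForcesZeroDefects); consumed by
DefectFreeCrystallizes; filed as its own decl so other routes can want it by signature. [difficulty:
XL] -/
@[route_item "route-AtomisticToContinuum-ReggeStarCoercivity"]
def ZeroDefectDensity : Prop :=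
  ∀ x : (N : ℕ) → (Fin N → EuclideanSpace ℝ (Fin 3)), (∀ N, Literature.MathematicalPhysics.StatisticalMechanics.IsGroundState Literature.MathematicalPhysics.StatisticalMechanics.lennardJones (x N)) → Filter.Tendsto (fun N : ℕ => (Nat.card {i : Fin N // ¬ ∃ a : ℝ, 9 / 10 ≤ a ∧ a ≤ 11 / 10 ∧ (Literature.Geometry.DiscreteGeometry.ShellCloseTo (1 / 20) ((Finset.univ.filter fun j : Fin N => j ≠ i ∧ dist (x N i) (x N j) ≤ 6 / 5).image fun j => a⁻¹ • (x N j - x N i)) Literature.Geometry.DiscreteGeometry.fccKissingPattern ∨ Literature.Geometry.DiscreteGeometry.ShellCloseTo (1 / 20) ((Finset.univ.filter fun j : Fin N => j ≠ i ∧ dist (x N i) (x N j) ≤ 6 / 5).image fun j => a⁻¹ • (x N j - x N i)) Literature.Geometry.DiscreteGeometry.hcpKissingPattern)} : ℝ) / N) Filter.atTop (nhds 0)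

/-- item stmt-AtomisticToContinuum-13605 · support · rank 9 · closed · proved by Summit.AtomisticToContinuum.Crystallization.Theorems.coercivityForcesZeroDefects_proof (prover) · by planner
sources: BlancLewin2015
[support] elementary real-analysis glue: StarCoercivity → CrysEnergyUpper → ZeroDefectDensity.
Proof: a ground state x^N is injective with E_LJ(x^N) = E(N); StarCoercivity gives g·#def ≤ E(N) −
N·e_per + C·N^(2/3); BlancLewin2015_8_holds (proved) gives E(N)/N → e_∞ and CrysEnergyUpper gives
e_∞ ≤ e_per, hence #def/N ≤ (E(N)/N − e_∞)/g + C·N^(−1/3)/g → 0. [difficulty: provable-now] -/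
@[route_item "route-AtomisticToContinuum-ReggeStarCoercivity"]
def CoercivityForcesZeroDefects : Prop :=
  StarCoercivity → CrysEnergyUpper → ZeroDefectDensity

-- `CoercivityForcesZeroDefects` holds: proved by `Summit.AtomisticToContinuum.Crystallization.Theorems.coercivityForcesZeroDefects_proof` (its module imports this route file, so no `_holds` link can be stated here).

/-- item stmt-AtomisticToContinuum-13606 · support · rank 9 · closed · proved by Summit.AtomisticToContinuum.Crystallization.Theorems.energyLimitGlue_proof @ 0ca23a0e53ab (prover) · by planner
sources: BlancLewin2015
[support] elementary glue for the energetic conjunct: StarCoercivity → CrysEnergyUpper →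
CrysPeriodicMinAttained → HasPeriodicGroundStateEnergy lennardJones 3. Proof: IsLeast P gives ⨅_Q
e(Q) = e(P) (IsLeast.csInf_eq) and BddBelow; StarCoercivity with the g-term dropped and le_ciInf
over injective configurations gives E(N)/N ≥ e(P) − C·N^(−1/3); with BlancLewin2015_8_holds (E(N)/N
→ e_∞, proved) this yields e_∞ ≥ e(P), CrysEnergyUpper yields e_∞ ≤ e(P), so E(N)/N → e(P) and ⟨P,
IsLeast, Tendsto⟩. [difficulty: provable-now] -/
@[route_item "route-AtomisticToContinuum-ReggeStarCoercivity"]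
def EnergyLimitGlue : Prop :=
  StarCoercivity → CrysEnergyUpper → CrysPeriodicMinAttained → Literature.MathematicalPhysics.StatisticalMechanics.HasPeriodicGroundStateEnergy Literature.MathematicalPhysics.StatisticalMechanics.lennardJones 3

-- `EnergyLimitGlue` holds: proved by `Summit.AtomisticToContinuum.Crystallization.Theorems.energyLimitGlue_proof` @ 0ca23a0e53ab (its module imports this route file, so no `_holds` link can be stated here).

/-- item stmt-AtomisticToContinuum-13607 · support · rank 9 · closed · proved by Summit.AtomisticToContinuum.Crystallization.Theorems.solidAngleFlatness_proof (prover) · by planner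
sources: Rogers1958, Coxeter1958
[support] 3-D Gauss–Bonnet is flatness, vertex form, as pure measure theory: for finitely many
non-degenerate tetrahedra conv(v, p_k0, p_k1, p_k2) sharing the apex v with pairwise disjoint
interiors, the unit-ball volume fractions at v of their apex cones (= solid angles/4π) sum to ≤ 1,
with equality when the tetrahedra cover a neighbourhood of v (cones are dilation invariant;
a.e.-disjointness + additivity of volume). This is N = Σ_t ω(t) at interior vertices, with the
inequality direction lower bounds need. [difficulty: provable-now] -/
@[route_item "route-AtomisticToContinuum-ReggeStarCoercivity"]
def SolidAngleFlatness : Prop :=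
  ∀ (n : ℕ) (v : EuclideanSpace ℝ (Fin 3)) (p : Fin n → Fin 3 → EuclideanSpace ℝ (Fin 3)), (∀ k, LinearIndependent ℝ (fun i => p k i - v)) → (∀ k l, k ≠ l → interior (convexHull ℝ (insert v (Set.range (p k)))) ∩ interior (convexHull ℝ (insert v (Set.range (p l)))) = ∅) → (∑ k, (volume (Metric.ball v 1 ∩ {q | ∃ c : Fin 3 → ℝ, (∀ i, 0 ≤ c i) ∧ q = v + ∑ i, c i • (p k i - v)})).toReal / (volume (Metric.ball v (1 : ℝ))).toReal ≤ 1) ∧ ((∃ r : ℝ, 0 < r ∧ Metric.ball v r ⊆ ⋃ k, convexHull ℝ (insert v (Set.range (p k)))) → ∑ k, (volume (Metric.ball v 1 ∩ {q | ∃ c : Fin 3 → ℝ, (∀ i, 0 ≤ c i) ∧ q = v + ∑ i, c i • (p k i - v)})).toReal / (volume (Metric.ball v (1 : ℝ))).toReal = 1)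

-- `SolidAngleFlatness` holds: proved by `Summit.AtomisticToContinuum.Crystallization.Theorems.solidAngleFlatness_proof` (its module imports this route file, so no `_holds` link can be stated here).

/-- item stmt-AtomisticToContinuum-13608 · support · rank 9 · closed · proved by Summit.AtomisticToContinuum.Crystallization.Theorems.dihedralFlatness_proof (prover) · by planner
sources: Regge1961, Coxeter1958, Rogers1958
[support] edge form (Regge: zero deficit angle at every interior edge of a flat triangulation): for
non-degenerate tetrahedra conv(v, w, p_k0, p_k1) sharing the edge vw with pairwise disjoint
interiors, the unit-ball volume fractions at v of their dihedral wedges ℝ(w−v) + cone(p_k0−v,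
p_k1−v) (= dihedral angle/2π) sum to ≤ 1, with equality when the tetrahedra cover a neighbourhood of
the midpoint of vw. Gives E_bonds = Σ_t ε(t) with ε(t) = Σ_edges (θ_e,t/2π)·V(|e|) — Coxeter's froth
sharing of each bond among the simplices around it. [difficulty: provable-now] -/
@[route_item "route-AtomisticToContinuum-ReggeStarCoercivity"]
def DihedralFlatness : Prop :=
  ∀ (n : ℕ) (v w : EuclideanSpace ℝ (Fin 3)) (p : Fin n → Fin 2 → EuclideanSpace ℝ (Fin 3)), (∀ k, LinearIndependent ℝ ![w - v, p k 0 - v, p k 1 - v]) → (∀ k l, k ≠ l → interior (convexHull ℝ ({v, w} ∪ Set.range (p k))) ∩ interior (convexHull ℝ ({v, w} ∪ Set.range (p l))) = ∅) → (∑ k, (volume (Metric.ball v 1 ∩ {q | ∃ s : ℝ, ∃ c : Fin 2 → ℝ, (∀ i, 0 ≤ c i) ∧ q = v + s • (w - v) + ∑ i, c i • (p k i - v)})).toReal / (volume (Metric.ball v (1 : ℝ))).toReal ≤ 1) ∧ ((∃ r : ℝ, 0 < r ∧ Metric.ball (midpoint ℝ v w) r ⊆ ⋃ k, convexHull ℝ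 ({v, w} ∪ Set.range (p k))) → ∑ k, (volume (Metric.ball v 1 ∩ {q | ∃ s : ℝ, ∃ c : Fin 2 → ℝ, (∀ i, 0 ≤ c i) ∧ q = v + s • (w - v) + ∑ i, c i • (p k i - v)})).toReal / (volume (Metric.ball v (1 : ℝ))).toReal = 1)

-- `DihedralFlatness` holds: proved by `Summit.AtomisticToContinuum.Crystallization.Theorems.dihedralFlatness_proof` (its module imports this route file, so no `_holds` link can be stated here).

/-- item stmt-AtomisticToContinuum-13609 · support · rank 9 · closed · proved by Summit.AtomisticToContinuum.Crystallization.Theorems.levelOneFrustrationGap_proof (prover) · by planner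
sources: Rogers1958, HalesDSP2012
[support] certified number (card deliverable (b) at level 1; energy twin of
fccDensity_lt_rogersBound): the regular unit tetrahedron's angle-weighted energy per unit
particle-weight, ε/ω = −θ/(4(3θ−π)) ∈ (−0.55824, −0.55816) with θ = arccos(1/3), lies strictly below
6·V(1) + V(√2) = −0.51953…, the Delaunay-edge energy per particle of the unit fcc lattice; so a RAW
per-simplex bound leaks by ≥ 7 % for the bond energy (Rogers: 5 % for density) —
TetrahedralFrustration made quantitative for energy; interval arithmetic from
tetDihedralAngle_bounds. [difficulty: provable-now] -/
@[route_item "route-AtomisticToContinuum-ReggeStarCoercivity"]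
def LevelOneFrustrationGap : Prop :=
  -(Real.arccos (1 / 3) / (4 * (3 * Real.arccos (1 / 3) - Real.pi))) < 6 * Literature.MathematicalPhysics.StatisticalMechanics.lennardJones 1 + Literature.MathematicalPhysics.StatisticalMechanics.lennardJones (Real.sqrt 2)

-- `LevelOneFrustrationGap` holds: proved by `Summit.AtomisticToContinuum.Crystallization.Theorems.levelOneFrustrationGap_proof` (its module imports this route file, so no `_holds` link can be stated here).

/-- item stmt-AtomisticToContinuum-13610 · support · rank 9 · closed · proved by Summit.AtomisticToContinuum.Crystallization.Theorems.sliverCellsUnbounded_proof (prover) · by planner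
sources: HalesDSP2012
[support] negative knowledge (the card's fastest refutation of RAW level 1, recorded as a lemma):
for every ℓ there is a non-degenerate tetrahedron with all six edge lengths in [1, 2] whose
dihedral-weighted LJ edge energy is < ℓ × its total solid-angle weight. Witness: slivers — four
points of a unit square lifted by h → 0 (the two diagonals get dihedral fraction → 1/2 each, ε →
V(√2) < 0, all four solid angles → 0). Hence cells must be merged or scores apportioned to stars
before any LP. [difficulty: provable-now] -/
@[route_item "route-AtomisticToContinuum-ReggeStarCoercivity"]
def SliverCellsUnbounded : Prop :=
  ∀ ℓ : ℝ, ∃ p : Fin 4 → EuclideanSpace ℝ (Fin 3), AffineIndependent ℝ p ∧ (∀ i j, i ≠ j → 1 ≤ dist (p i) (p j) ∧ dist (p i) (p j) ≤ 2) ∧ (∑ i : Fin 4, ∑ j ∈ Finset.Ioi i, (volume (Metric.ball (p i) 1 ∩ {q | ∃ s : ℝ, ∃ c : Fin 4 → ℝ, (∀ k, 0 ≤ c k) ∧ q - p i = s • (p j - p i) + ∑ k, c k • (p k - p i)})).toReal / (volume (Metric.ball (p i) (1 : ℝ))).toReal * Literature.MathematicalPhysics.StatisticalMechanics.lennardJones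 (dist (p i) (p j))) < ℓ * ∑ i : Fin 4, (volume (Metric.ball (p i) 1 ∩ {q | ∃ c : Fin 4 → ℝ, (∀ k, 0 ≤ c k) ∧ q - p i = ∑ k, c k • (p k - p i)})).toReal / (volume (Metric.ball (p i) (1 : ℝ))).toReal

-- `SliverCellsUnbounded` holds: proved by `Summit.AtomisticToContinuum.Crystallization.Theorems.sliverCellsUnbounded_proof` (its module imports this route file, so no `_holds` link can be stated here).

/-- item stmt-AtomisticToContinuum-13611 · assembly · rank 1 · closed · proved by Summit.AtomisticToContinuum.Crystallization.Theorems.reggeStarCoercivity_assembly_proof @ b4710e7544ac (prover) · by planner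
sources: BlancLewin2015
[assembly] StarCoercivity → CrysEnergyUpper → CrysPeriodicMinAttained → CoercivityForcesZeroDefects
→ DefectFreeCrystallizes → EnergyLimitGlue → Crystallization (proved in Sketch.lean as
`assembly_holds`, one line). -/
@[route_item "route-AtomisticToContinuum-ReggeStarCoercivity"]
def Assembly : Prop :=
  StarCoercivity → CrysEnergyUpper → CrysPeriodicMinAttained → CoercivityForcesZeroDefects → DefectFreeCrystallizes → EnergyLimitGlue → _root_.Crystallization

-- `Assembly` holds: proved by `Summit.AtomisticToContinuum.Crystallization.Theorems.reggeStarCoercivity_assembly_proof` @ b4710e7544ac (its module imports this route file, so no `_holds` link can be stated here).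

/-! D-0027 §2.1 — DECIDING THEOREM (planner-authored via `route open/edit --closes-file`; by planner-plancard-AtomisticToContinuum-Crystal-8fa53ff6-g2-0 2026-08-15T19:02:27Z):
its hypotheses are this route's items and its conclusion the sub-problem Statement (glue_lint), and it elaborates with this file. -/

@[closes "route-AtomisticToContinuum-ReggeStarCoercivity"] theorem closes : StarCoercivity → StabilityConstantTwelve → PeriodicStarCoercivity → DefectFreeCrystallizes →
    CrysEnergyUpper → CrysPeriodicMinAttained → ZeroDefectDensity → CoercivityForcesZeroDefects → EnergyLimitGlue →
    SolidAngleFlatness → DihedralFlatness → LevelOneFrustrationGap → SliverCellsUnbounded → Assembly → _root_.Crystallization :=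
  fun hSC _ _ hDFC hUp hMin _ hCFZ hELG _ _ _ _ _ => ⟨hELG hSC hUp hMin, hDFC (hCFZ hSC hUp)⟩

end Summit.AtomisticToContinuum.Crystallization.Theses.ReggeStarCoercivity
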